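import Literature.Analysis.SpecialFunctions.SpheroidalHarmonicSeries
import Literature.Analysis.ODE.LinearSecondOrder
import HarnessLib

/-!
# Even eigenfunctions of the `m`-spheroidal equation from zeros of the shooting function

Topic `Literature/Analysis/SpecialFunctions` (namespace `Literature.Analysis.SpecialFunctions`),
continuing `SpheroidalHarmonicSeries.lean`. There, for every `m : ℕ` and complex `(ν, κ)`, the
Frobenius solution `q(t) = Σ cₖ tᵏ` of
  `t(2 − t) q'' + 2(m+1)(1 − t) q' + (ν + κ(1 − t)²) q = 0`
(the `m`-spheroidal equation `(1 − x²) q'' − 2(m+1) x q' + (ν + κx²) q = 0` in `t = 1 − x`,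
`x = cos θ`; Shlapentokh-Rothman, CMP 329 (2014), §2 (2.1) with `S = sin^m θ · q`,
`ν = λ − m(m+1)`, `κ = a²(ω² − μ²)`) was constructed on `‖t‖ < 5/4`, analytic at the pole `x = 1`.
This file performs the **shooting/gluing step** of the construction of the angular eigenfunctions
(SR App. B), for all `m` and COMPLEX parameters:

* `hasDerivAt_sphmFun_comp_sub/add` — in the latitude variable `x ∈ (−1/4, 1/4)` both the pole
  solution `x ↦ q(1 − x)` and its reflection `x ↦ q(1 + x)` (the solution analytic at the other
  pole `x = −1`, by the symmetry `x ↦ −x` of the equation) solve the regular linear equation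
  `u'' = (2(m+1)x u' − (ν + κx²) u)/(1 − x²)`;
* `sphmFun_reflect` — **evenness from the shooting condition**: if `q'(t = 1) = 0`
  (`sphmDer m ν κ 1 = 0`, i.e. `dq/dx = 0` at the equator `x = 0`) then `q(1 + x) = q(1 − x)` on
  `(−1/4, 1/4)` (uniqueness at the ordinary point `x = 0`,
  `Literature.Analysis.ODE.eqOn_of_solution_Ioo` over `ℂ`);
* `sphmEig m ν κ x = q(1 − |x|)` — the glued even function; under the shooting condition it is
  `C^∞` on `(−9/4, 9/4) ⊃ [−1, 1]` (`contDiffAt_sphmEig`), equals `1` at both poles, and solves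
  `(1 − x²) E'' − 2(m+1) x E' + (ν + κx²) E = 0` there with genuine derivatives (`sphmEig_ode`) —
  so that `S(θ) = sin^m θ · E(cos θ)` is an angular eigenfunction smooth across both poles;
* reality for real parameters (`im_sphmEig`).

The existence of zeros of the shooting function `(ν, κ) ↦ q'(1; m, ν, κ)` (at `κ = 0`:
`ν = (l − m)(l + m + 1)`, `l − m` even) and their continuation in `κ` are the subject of the sequel.

## References

* Y. Shlapentokh-Rothman, Comm. Math. Phys. 329 (2014) 859–891, §2 (2.1), App. B ("the condition
  that `e^{imφ} S_{ml}(θ)` extends to `𝕊²`"; the eigenvalue curves `λ_{ml}`).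
  Key `ShlapentokhRothman2014KleinGordon`.
* P. Hartman, *Ordinary Differential Equations*, SIAM Classics 38 (2002), Ch. IV §12 (regular
  singular points), Ch. IV Lemma 1.1 (uniqueness). Key `Hartman2002`.
-/

noncomputable section

open Set Filter Metric Topology
open scoped ContDiff

namespace Literature.Analysis.SpecialFunctions

open Literature.Analysis.ODE

section Chi

variable {m : ℕ} {ν κ : ℂ}

/-- `t ↦ q(t)` is `Cⁿ` (over `ℂ`) at every `t` of the disc `‖t‖ < 5/4`. [folklore] -/
theorem contDiffAt_sphmFun {t : ℂ} (ht : ‖t‖ < 5 / 4) {n : WithTop ℕ∞} (hn : n ≤ ∞) :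
    ContDiffAt ℂ n (sphmFun m ν κ) t := by
  have hmem : (t, (ν, κ)) ∈ {q : ℂ × (ℂ × ℂ) | ‖q.1‖ < 5 / 4 ∧ ‖q.2.1‖ + ‖q.2.2‖ < ‖ν‖ + ‖κ‖ + 1} :=
    ⟨ht, by simp⟩
  have h := (contDiffOn_sphmFun m (‖ν‖ + ‖κ‖ + 1) hn).contDiffAt ((isOpen_region _).mem_nhds hmem)
  exact h.comp t (contDiffAt_id.prodMk contDiffAt_const)

/-- The norm condition `‖1 − x‖ < 5/4` for real `x ∈ (−1/4, 9/4)`. [folklore] -/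
theorem norm_one_sub_lt {x : ℝ} (hx : x ∈ Ioo (-1 / 4 : ℝ) (9 / 4)) : ‖(1 : ℂ) - (x : ℂ)‖ < 5 / 4 := by
  rw [show (1 : ℂ) - (x : ℂ) = ((1 - x : ℝ) : ℂ) by push_cast; ring, Complex.norm_real, Real.norm_eq_abs, abs_lt]
  constructor <;> linarith [hx.1, hx.2]

/-- The norm condition `‖1 + x‖ < 5/4` for real `x ∈ (−9/4, 1/4)`. [folklore] -/
theorem norm_one_add_lt {x : ℝ} (hx : x ∈ Ioo (-9 / 4 : ℝ) (1 / 4)) : ‖(1 : ℂ) + (x : ℂ)‖ < 5 / 4 := by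
  rw [show (1 : ℂ) + (x : ℂ) = ((1 + x : ℝ) : ℂ) by push_cast; ring, Complex.norm_real, Real.norm_eq_abs, abs_lt]
  constructor <;> linarith [hx.1, hx.2]

/-- `d/dx (1 − x) = −1` as a map `ℝ → ℂ`. [folklore] -/
theorem hasDerivAt_one_sub_ofReal (x : ℝ) : HasDerivAt (fun y : ℝ ↦ (1 : ℂ) - (y : ℂ)) (-1) x := by
  simpa using ((hasDerivAt_id x).ofReal_comp).const_sub (1 : ℂ)

/-- `d/dx (1 + x) = 1` as a map `ℝ → ℂ`. [folklore] -/
theorem hasDerivAt_one_add_ofReal (x : ℝ) : HasDerivAt (fun y : ℝ ↦ (1 : ℂ) + (y : ℂ)) 1 x := by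
  simpa using ((hasDerivAt_id x).ofReal_comp).const_add (1 : ℂ)

/-- **The pole solution in the latitude variable**: `u(x) = q(1 − x)` satisfies on `(−1/4, 1/4)`
`u' = −q'(1 − x)` and `u'' = (2(m+1)x u' − (ν + κx²) u)/(1 − x²)`. [folklore] -/
theorem hasDerivAt_sphmFun_comp_sub {x : ℝ} (hx : x ∈ Ioo (-1 / 4 : ℝ) (1 / 4)) :
    HasDerivAt (fun y : ℝ ↦ sphmFun m ν κ (1 - (y : ℂ))) (-sphmDer m ν κ (1 - (x : ℂ))) x ∧
    HasDerivAt (fun y : ℝ ↦ -sphmDer m ν κ (1 - (y : ℂ)))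
      (((2 * ((m : ℂ) + 1) * x / (1 - (x : ℂ) ^ 2)) : ℂ) * (-sphmDer m ν κ (1 - (x : ℂ))) +
        (-(ν + κ * (x : ℂ) ^ 2) / (1 - (x : ℂ) ^ 2)) * sphmFun m ν κ (1 - (x : ℂ))) x := by
  have hx' : x ∈ Ioo (-1 / 4 : ℝ) (9 / 4) := ⟨hx.1, by linarith [hx.2]⟩
  have hs : ‖(1 : ℂ) - (x : ℂ)‖ < 5 / 4 := norm_one_sub_lt hx'
  have hx1 : (1 : ℂ) - (x : ℂ) ^ 2 ≠ 0 := by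
    have h : (1 : ℝ) - x ^ 2 ≠ 0 := by nlinarith [hx.1, hx.2]
    exact_mod_cast h
  have hode := sphmFun_ode (m := m) (ν := ν) (κ := κ) hs
  have key : sphmDer2 m ν κ (1 - (x : ℂ)) * (1 - (x : ℂ) ^ 2) =
      -(2 * ((m : ℂ) + 1) * x) * sphmDer m ν κ (1 - (x : ℂ)) - (ν + κ * (x : ℂ) ^ 2) * sphmFun m ν κ (1 - (x : ℂ)) := by
    linear_combination hode
  constructor
  · have h := (hasDerivAt_sphmFun (m := m) (ν := ν) (κ := κ) hs).comp x (hasDerivAt_one_sub_ofReal x)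
    simpa [Function.comp_def] using h
  · have h0 : HasDerivAt (fun y : ℝ ↦ sphmDer m ν κ (1 - (y : ℂ))) (sphmDer2 m ν κ (1 - (x : ℂ)) * (-1)) x := by
      simpa [Function.comp_def] using (hasDerivAt_sphmDer (m := m) (ν := ν) (κ := κ) hs).comp x (hasDerivAt_one_sub_ofReal x)
    have h' : HasDerivAt (fun y : ℝ ↦ -sphmDer m ν κ (1 - (y : ℂ))) (sphmDer2 m ν κ (1 - (x : ℂ))) x := by
      simpa using h0.fun_neg
    have hval : 2 * ((m : ℂ) + 1) * x / (1 - (x : ℂ) ^ 2) * (-sphmDer m ν κ (1 - (x : ℂ))) +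
        (-(ν + κ * (x : ℂ) ^ 2) / (1 - (x : ℂ) ^ 2)) * sphmFun m ν κ (1 - (x : ℂ)) = sphmDer2 m ν κ (1 - (x : ℂ)) := by
      rw [div_mul_eq_mul_div, div_mul_eq_mul_div, ← add_div, div_eq_iff hx1]
      linear_combination -key
    rw [hval]
    exact h'

/-- **The reflected pole solution** `u(x) = q(1 + x)` (analytic at `x = −1`) satisfies the same
regular equation on `(−1/4, 1/4)`, with `u' = q'(1 + x)`. [folklore] -/
theorem hasDerivAt_sphmFun_comp_add {x : ℝ} (hx : x ∈ Ioo (-1 / 4 : ℝ) (1 / 4)) :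
    HasDerivAt (fun y : ℝ ↦ sphmFun m ν κ (1 + (y : ℂ))) (sphmDer m ν κ (1 + (x : ℂ))) x ∧
    HasDerivAt (fun y : ℝ ↦ sphmDer m ν κ (1 + (y : ℂ)))
      (((2 * ((m : ℂ) + 1) * x / (1 - (x : ℂ) ^ 2)) : ℂ) * sphmDer m ν κ (1 + (x : ℂ)) +
        (-(ν + κ * (x : ℂ) ^ 2) / (1 - (x : ℂ) ^ 2)) * sphmFun m ν κ (1 + (x : ℂ))) x := by
  have hx' : x ∈ Ioo (-9 / 4 : ℝ) (1 / 4) := ⟨by linarith [hx.1], hx.2⟩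
  have hs : ‖(1 : ℂ) + (x : ℂ)‖ < 5 / 4 := norm_one_add_lt hx'
  have hx1 : (1 : ℂ) - (x : ℂ) ^ 2 ≠ 0 := by
    have h : (1 : ℝ) - x ^ 2 ≠ 0 := by nlinarith [hx.1, hx.2]
    exact_mod_cast h
  have hode := sphmFun_ode (m := m) (ν := ν) (κ := κ) hs
  have key : sphmDer2 m ν κ (1 + (x : ℂ)) * (1 - (x : ℂ) ^ 2) =
      2 * ((m : ℂ) + 1) * x * sphmDer m ν κ (1 + (x : ℂ)) - (ν + κ * (x : ℂ) ^ 2) * sphmFun m ν κ (1 + (x : ℂ)) := by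
    linear_combination hode
  constructor
  · have h := (hasDerivAt_sphmFun (m := m) (ν := ν) (κ := κ) hs).comp x (hasDerivAt_one_add_ofReal x)
    simpa [Function.comp_def] using h
  · have h := (hasDerivAt_sphmDer (m := m) (ν := ν) (κ := κ) hs).comp x (hasDerivAt_one_add_ofReal x)
    have h' : HasDerivAt (fun y : ℝ ↦ sphmDer m ν κ (1 + (y : ℂ))) (sphmDer2 m ν κ (1 + (x : ℂ))) x := by
      simpa [Function.comp_def] using h
    have hval : 2 * ((m : ℂ) + 1) * x / (1 - (x : ℂ) ^ 2) * sphmDer m ν κ (1 + (x : ℂ)) +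
        (-(ν + κ * (x : ℂ) ^ 2) / (1 - (x : ℂ) ^ 2)) * sphmFun m ν κ (1 + (x : ℂ)) = sphmDer2 m ν κ (1 + (x : ℂ)) := by
      rw [div_mul_eq_mul_div, div_mul_eq_mul_div, ← add_div, div_eq_iff hx1]
      linear_combination -key
    rw [hval]
    exact h'

/-- **Evenness from the vanishing of the shooting function.** If `q'(1) = 0` then
`q(1 + x) = q(1 − x)` for `x ∈ (−1/4, 1/4)`: both sides solve the regular linear equation
`u'' = (2(m+1)x u' − (ν + κx²)u)/(1 − x²)` with the same value `q(1)` and the same derivative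
`0` at the ordinary point `x = 0` (`Literature.Analysis.ODE.eqOn_of_solution_Ioo` over `ℂ`).
SR, CMP 329 (2014), App. B (regularity at both poles as the eigenvalue condition).
[cite: ShlapentokhRothman2014KleinGordon, App. B] -/
theorem sphmFun_reflect (hg : sphmDer m ν κ 1 = 0) {x : ℝ} (hx : x ∈ Ioo (-1 / 4 : ℝ) (1 / 4)) :
    sphmFun m ν κ (1 + (x : ℂ)) = sphmFun m ν κ (1 - (x : ℂ)) := by
  have hden : ∀ y ∈ Ioo (-1 / 4 : ℝ) (1 / 4), (1 : ℂ) - (y : ℂ) ^ 2 ≠ 0 := fun y hy ↦ by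
    have h : (1 : ℝ) - y ^ 2 ≠ 0 := by nlinarith [hy.1, hy.2]
    exact_mod_cast h
  have hp : ContinuousOn (fun y : ℝ ↦ (2 * ((m : ℂ) + 1) * y / (1 - (y : ℂ) ^ 2) : ℂ)) (Ioo (-1 / 4 : ℝ) (1 / 4)) :=
    ContinuousOn.div (by fun_prop) (by fun_prop) hden
  have hq : ContinuousOn (fun y : ℝ ↦ (-(ν + κ * (y : ℂ) ^ 2) / (1 - (y : ℂ) ^ 2) : ℂ)) (Ioo (-1 / 4 : ℝ) (1 / 4)) :=
    ContinuousOn.div (by fun_prop) (by fun_prop) hden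
  have h0 : (0 : ℝ) ∈ Ioo (-1 / 4 : ℝ) (1 / 4) := ⟨by norm_num, by norm_num⟩
  have huniq := Literature.Analysis.ODE.eqOn_of_solution_Ioo (𝕜 := ℂ) hp hq h0
    (u := fun y : ℝ ↦ sphmFun m ν κ (1 + (y : ℂ))) (u' := fun y : ℝ ↦ sphmDer m ν κ (1 + (y : ℂ)))
    (v := fun y : ℝ ↦ sphmFun m ν κ (1 - (y : ℂ))) (v' := fun y : ℝ ↦ -sphmDer m ν κ (1 - (y : ℂ)))
    (fun y hy ↦ hasDerivAt_sphmFun_comp_add hy) (fun y hy ↦ hasDerivAt_sphmFun_comp_sub hy)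
    (by simp) (by simp [hg])
  exact huniq.1 hx

end Chi

/-! ### The glued even eigenfunction -/

/-- **The even `m`-spheroidal eigenfunction candidate** `E(x) = q(1 − |x|; m, ν, κ)` (the pole
solution on `x ≥ 0`, its reflection on `x ≤ 0`). Under the shooting condition `q'(1) = 0` it is
smooth on `(−9/4, 9/4)` and solves `(1 − x²) E'' − 2(m+1) x E' + (ν + κx²) E = 0` there
(`sphmEig_ode`); the angular eigenfunction is then `S(θ) = sin^m θ · E(cos θ)`.
SR, CMP 329 (2014), §2 (2.1) and App. B. [cite: ShlapentokhRothman2014KleinGordon, §2 (2.1)] -/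
def sphmEig (m : ℕ) (ν κ : ℂ) (x : ℝ) : ℂ := sphmFun m ν κ (1 - (|x| : ℝ))

/-- `E` is even. [folklore] -/
theorem sphmEig_neg (m : ℕ) (ν κ : ℂ) (x : ℝ) : sphmEig m ν κ (-x) = sphmEig m ν κ x := by
  simp [sphmEig]

/-- `E(1) = q(0) = 1`. [folklore] -/
theorem sphmEig_one (m : ℕ) (ν κ : ℂ) : sphmEig m ν κ 1 = 1 := by
  simp [sphmEig, sphmFun_zero]

/-- `E(−1) = 1`. [folklore] -/
theorem sphmEig_neg_one (m : ℕ) (ν κ : ℂ) : sphmEig m ν κ (-1) = 1 := by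
  rw [sphmEig_neg, sphmEig_one]

/-- `E(0) = q(1)`. [folklore] -/
theorem sphmEig_zero (m : ℕ) (ν κ : ℂ) : sphmEig m ν κ 0 = sphmFun m ν κ 1 := by
  simp [sphmEig]

section Glue

variable {m : ℕ} {ν κ : ℂ} (hg : sphmDer m ν κ 1 = 0)
include hg

/-- Near every `x > −1/4` the glued function is the pole solution `q(1 − x)`. [folklore] -/
theorem sphmEig_eventuallyEq_sub {x : ℝ} (hx : -1 / 4 < x) :
    sphmEig m ν κ =ᶠ[𝓝 x] fun y : ℝ ↦ sphmFun m ν κ (1 - (y : ℂ)) := by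
  rcases lt_or_ge x (1 / 4) with h | h
  · filter_upwards [Ioo_mem_nhds hx h] with y hy
    unfold sphmEig
    rcases le_or_gt 0 y with hy0 | hy0
    · rw [abs_of_nonneg hy0]
    · rw [abs_of_neg hy0, Complex.ofReal_neg, sub_neg_eq_add]
      exact sphmFun_reflect hg hy
  · filter_upwards [Ioi_mem_nhds (show (0 : ℝ) < x by linarith)] with y hy
    unfold sphmEig
    rw [abs_of_pos hy]

/-- Near every `x < 1/4` the glued function is the reflected pole solution `q(1 + x)`. [folklore] -/
theorem sphmEig_eventuallyEq_add {x : ℝ} (hx : x < 1 / 4) :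
    sphmEig m ν κ =ᶠ[𝓝 x] fun y : ℝ ↦ sphmFun m ν κ (1 + (y : ℂ)) := by
  rcases lt_or_ge (-1 / 4) x with h | h
  · filter_upwards [Ioo_mem_nhds h hx] with y hy
    unfold sphmEig
    rcases le_or_gt 0 y with hy0 | hy0
    · rw [abs_of_nonneg hy0]
      exact (sphmFun_reflect hg hy).symm
    · rw [abs_of_neg hy0, Complex.ofReal_neg, sub_neg_eq_add]
  · filter_upwards [Iio_mem_nhds (show x < 0 by linarith)] with y hy
    unfold sphmEig
    rw [abs_of_neg hy, Complex.ofReal_neg, sub_neg_eq_add]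

/-- **Smoothness across both poles**: under the shooting condition the glued function is `Cⁿ`
(every `n ≤ ∞`, over `ℝ`) at every `x ∈ (−9/4, 9/4)`. [cite: ShlapentokhRothman2014KleinGordon, App. B] -/
theorem contDiffAt_sphmEig {x : ℝ} (hx : x ∈ Ioo (-9 / 4 : ℝ) (9 / 4)) {n : WithTop ℕ∞} (hn : n ≤ ∞) :
    ContDiffAt ℝ n (sphmEig m ν κ) x := by
  rcases lt_or_ge x (1 / 4) with h | h
  · have hs : ‖(1 : ℂ) + (x : ℂ)‖ < 5 / 4 := norm_one_add_lt ⟨hx.1, h⟩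
    have hsm : ContDiffAt ℝ n (fun y : ℝ ↦ sphmFun m ν κ (1 + (y : ℂ))) x :=
      ((contDiffAt_sphmFun hs hn).restrict_scalars ℝ).comp x
        (contDiffAt_const.add Complex.ofRealCLM.contDiff.contDiffAt)
    exact hsm.congr_of_eventuallyEq (sphmEig_eventuallyEq_add hg h)
  · have hs : ‖(1 : ℂ) - (x : ℂ)‖ < 5 / 4 := norm_one_sub_lt ⟨by linarith, hx.2⟩
    have hsm : ContDiffAt ℝ n (fun y : ℝ ↦ sphmFun m ν κ (1 - (y : ℂ))) x :=
      ((contDiffAt_sphmFun hs hn).restrict_scalars ℝ).comp x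
        (contDiffAt_const.sub Complex.ofRealCLM.contDiff.contDiffAt)
    exact hsm.congr_of_eventuallyEq (sphmEig_eventuallyEq_sub hg (by linarith))

/-- `E` is `C^∞` on `(−9/4, 9/4)`. [cite: ShlapentokhRothman2014KleinGordon, App. B] -/
theorem contDiffOn_sphmEig : ContDiffOn ℝ ∞ (sphmEig m ν κ) (Ioo (-9 / 4 : ℝ) (9 / 4)) :=
  fun _ hx ↦ (contDiffAt_sphmEig hg hx le_rfl).contDiffWithinAt

/-- **The `m`-spheroidal equation for the glued eigenfunction** on `(−9/4, 9/4)`: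
`(1 − x²) E'' − 2(m+1) x E' + (ν + κx²) E = 0` with genuine derivatives `deriv E`,
`deriv (deriv E)`. SR, CMP 329 (2014), §2 (2.1) (after `S = sin^m θ · E(cos θ)`).
[cite: ShlapentokhRothman2014KleinGordon, §2 (2.1)] -/
theorem sphmEig_ode {x : ℝ} (hx : x ∈ Ioo (-9 / 4 : ℝ) (9 / 4)) :
    (1 - (x : ℂ) ^ 2) * deriv (deriv (sphmEig m ν κ)) x - 2 * ((m : ℂ) + 1) * x * deriv (sphmEig m ν κ) x +
      (ν + κ * (x : ℂ) ^ 2) * sphmEig m ν κ x = 0 := by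
  rcases lt_or_ge x (1 / 4) with h | h
  · -- use the reflected pole solution `y ↦ q(1 + y)`
    have hs : ‖(1 : ℂ) + (x : ℂ)‖ < 5 / 4 := norm_one_add_lt ⟨hx.1, h⟩
    have hloc := sphmEig_eventuallyEq_add hg h
    have hD1 : ∀ y : ℝ, ‖(1 : ℂ) + (y : ℂ)‖ < 5 / 4 →
        HasDerivAt (fun z : ℝ ↦ sphmFun m ν κ (1 + (z : ℂ))) (sphmDer m ν κ (1 + (y : ℂ))) y := fun y hy ↦ by
      simpa [Function.comp_def] using (hasDerivAt_sphmFun (m := m) (ν := ν) (κ := κ) hy).comp y (hasDerivAt_one_add_ofReal y)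
    have hderiv_loc : deriv (sphmEig m ν κ) =ᶠ[𝓝 x] fun y ↦ sphmDer m ν κ (1 + (y : ℂ)) := by
      have hopen : ∀ᶠ y : ℝ in 𝓝 x, ‖(1 : ℂ) + (y : ℂ)‖ < 5 / 4 := by
        filter_upwards [Ioo_mem_nhds hx.1 h] with y hy using norm_one_add_lt hy
      filter_upwards [hloc.eventually_nhds, hopen] with y hy hy'
      rw [Filter.EventuallyEq.deriv_eq hy]
      exact (hD1 y hy').deriv
    have e0 : sphmEig m ν κ x = sphmFun m ν κ (1 + (x : ℂ)) := hloc.eq_of_nhds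
    have e1 : deriv (sphmEig m ν κ) x = sphmDer m ν κ (1 + (x : ℂ)) := hderiv_loc.eq_of_nhds
    have e2 : deriv (deriv (sphmEig m ν κ)) x = sphmDer2 m ν κ (1 + (x : ℂ)) := by
      rw [hderiv_loc.deriv_eq]
      have := (hasDerivAt_sphmDer (m := m) (ν := ν) (κ := κ) hs).comp x (hasDerivAt_one_add_ofReal x)
      simpa [Function.comp_def] using this.deriv
    rw [e0, e1, e2]
    have hode := sphmFun_ode (m := m) (ν := ν) (κ := κ) hs
    linear_combination hode
  · -- use the pole solution `y ↦ q(1 - y)`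
    have hs : ‖(1 : ℂ) - (x : ℂ)‖ < 5 / 4 := norm_one_sub_lt ⟨by linarith, hx.2⟩
    have hloc := sphmEig_eventuallyEq_sub hg (show (-1 / 4 : ℝ) < x by linarith)
    have hD1 : ∀ y : ℝ, ‖(1 : ℂ) - (y : ℂ)‖ < 5 / 4 →
        HasDerivAt (fun z : ℝ ↦ sphmFun m ν κ (1 - (z : ℂ))) (-sphmDer m ν κ (1 - (y : ℂ))) y := fun y hy ↦ by
      simpa [Function.comp_def] using (hasDerivAt_sphmFun (m := m) (ν := ν) (κ := κ) hy).comp y (hasDerivAt_one_sub_ofReal y)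
    have hderiv_loc : deriv (sphmEig m ν κ) =ᶠ[𝓝 x] fun y ↦ -sphmDer m ν κ (1 - (y : ℂ)) := by
      have hopen : ∀ᶠ y : ℝ in 𝓝 x, ‖(1 : ℂ) - (y : ℂ)‖ < 5 / 4 := by
        filter_upwards [Ioo_mem_nhds (show (-1 / 4 : ℝ) < x by linarith) hx.2] with y hy using norm_one_sub_lt hy
      filter_upwards [hloc.eventually_nhds, hopen] with y hy hy'
      rw [Filter.EventuallyEq.deriv_eq hy]
      exact (hD1 y hy').deriv
    have e0 : sphmEig m ν κ x = sphmFun m ν κ (1 - (x : ℂ)) := hloc.eq_of_nhds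
    have e1 : deriv (sphmEig m ν κ) x = -sphmDer m ν κ (1 - (x : ℂ)) := hderiv_loc.eq_of_nhds
    have e2 : deriv (deriv (sphmEig m ν κ)) x = sphmDer2 m ν κ (1 - (x : ℂ)) := by
      rw [hderiv_loc.deriv_eq]
      have := ((hasDerivAt_sphmDer (m := m) (ν := ν) (κ := κ) hs).comp x (hasDerivAt_one_sub_ofReal x)).neg
      simpa [Function.comp_def] using this.deriv
    rw [e0, e1, e2]
    have hode := sphmFun_ode (m := m) (ν := ν) (κ := κ) hs
    linear_combination hode

/-- The first derivative of the glued function has the expected one-sided forms: near `x > −1/4`,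
`E' = −q'(1 − x)`. [folklore] -/
theorem deriv_sphmEig_of_gt {x : ℝ} (hx : x ∈ Ioo (-1 / 4 : ℝ) (9 / 4)) :
    deriv (sphmEig m ν κ) x = -sphmDer m ν κ (1 - (x : ℂ)) := by
  have hloc := sphmEig_eventuallyEq_sub hg hx.1
  rw [hloc.deriv_eq]
  have h := (hasDerivAt_sphmFun (m := m) (ν := ν) (κ := κ) (norm_one_sub_lt hx)).comp x (hasDerivAt_one_sub_ofReal x)
  simpa [Function.comp_def] using h.deriv

/-- `E'(0) = 0` (the shooting condition). [folklore] -/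
theorem deriv_sphmEig_zero : deriv (sphmEig m ν κ) 0 = 0 := by
  rw [deriv_sphmEig_of_gt hg ⟨by norm_num, by norm_num⟩]
  simp [hg]

end Glue

/-- **Reality**: for real parameters the glued function is real. [folklore] -/
theorem im_sphmEig {m : ℕ} {ν κ : ℂ} (hν : ν.im = 0) (hκ : κ.im = 0) {x : ℝ} (hx : x ∈ Ioo (-9 / 4 : ℝ) (9 / 4)) :
    (sphmEig m ν κ x).im = 0 := by
  unfold sphmEig
  rw [show (1 : ℂ) - ((|x| : ℝ) : ℂ) = ((1 - |x| : ℝ) : ℂ) by push_cast; ring]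
  refine im_sphmFun_ofReal (m := m) hν hκ ?_
  have h1 : |x| < 9 / 4 := by
    rw [abs_lt]; constructor <;> linarith [hx.1, hx.2]
  rw [abs_lt]
  constructor <;> linarith [abs_nonneg x]

/-! ### The angular eigenfunction `S(θ) = sin^m θ · E(cos θ)` and the spheroidal equation in `θ` -/

section Theta

variable {m : ℕ} {ν κ : ℂ}

/-- **The angular function** `S(θ) = sin^m θ · E(cos θ)` attached to the glued even solution `E`
(for a zero of the shooting function this is the spheroidal harmonic `S_{ml}` of SR up to
normalisation). SR, CMP 329 (2014), §2 (2.1). [cite: ShlapentokhRothman2014KleinGordon, §2 (2.1)] -/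
def sphmAng (m : ℕ) (ν κ : ℂ) (θ : ℝ) : ℂ := (Real.sin θ : ℂ) ^ m * sphmEig m ν κ (Real.cos θ)

/-- `d/dθ sin^m θ = m sin^{m-1} θ cos θ` (complex-valued). [folklore] -/
theorem hasDerivAt_sin_pow (m : ℕ) (θ : ℝ) :
    HasDerivAt (fun t : ℝ ↦ (Real.sin t : ℂ) ^ m) ((m : ℂ) * (Real.sin θ : ℂ) ^ (m - 1) * (Real.cos θ : ℂ)) θ := by
  have h := (hasDerivAt_pow m (Real.sin θ : ℂ)).comp θ (Real.hasDerivAt_sin θ).ofReal_comp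
  exact h

/-- The power identity `m · (z · z^{m-1}) = m · z^m` (both sides vanish for `m = 0`). [folklore] -/
theorem natCast_mul_mul_pow_sub_one (m : ℕ) (z : ℂ) : (m : ℂ) * (z * z ^ (m - 1)) = (m : ℂ) * z ^ m := by
  cases m with
  | zero => simp
  | succ k => rw [Nat.add_sub_cancel, ← pow_succ']

/-- `cos θ ∈ (−9/4, 9/4)`. [folklore] -/
theorem cos_mem_Ioo (θ : ℝ) : Real.cos θ ∈ Ioo (-9 / 4 : ℝ) (9 / 4) :=
  ⟨by linarith [Real.neg_one_le_cos θ], by linarith [Real.cos_le_one θ]⟩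

variable (hg : sphmDer m ν κ 1 = 0)
include hg

/-- `E` is differentiable at `cos θ` with derivative `deriv E (cos θ)`. [folklore] -/
theorem hasDerivAt_sphmEig_cos (θ : ℝ) :
    HasDerivAt (sphmEig m ν κ) (deriv (sphmEig m ν κ) (Real.cos θ)) (Real.cos θ) :=
  ((contDiffAt_sphmEig hg (cos_mem_Ioo θ) le_rfl).differentiableAt (by simp)).hasDerivAt

/-- `deriv E` is differentiable at `cos θ` with derivative `deriv (deriv E) (cos θ)`. [folklore] -/
theorem hasDerivAt_deriv_sphmEig_cos (θ : ℝ) :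
    HasDerivAt (deriv (sphmEig m ν κ)) (deriv (deriv (sphmEig m ν κ)) (Real.cos θ)) (Real.cos θ) := by
  have h1 : ContDiffOn ℝ ∞ (deriv (sphmEig m ν κ)) (Ioo (-9 / 4 : ℝ) (9 / 4)) :=
    (contDiffOn_sphmEig hg).deriv_of_isOpen isOpen_Ioo le_rfl
  exact ((h1.differentiableOn (by simp)).differentiableAt (isOpen_Ioo.mem_nhds (cos_mem_Ioo θ))).hasDerivAt

/-- **The spheroidal equation in the polar angle.** For a zero of the shooting function, the
angular function `S(θ) = sin^m θ · E(cos θ)` satisfies on `(0, π)`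
`(1/sin θ)(sin θ S')' − (m²/sin²θ − κ cos²θ) S + (ν + m(m+1)) S = 0`
with genuine derivatives — equation (2.1) of Shlapentokh-Rothman, CMP 329 (2014), §2, with
`λ = ν + m(m+1)` and `κ = a²(ω² − μ²)`. [cite: ShlapentokhRothman2014KleinGordon, §2 (2.1)] -/
theorem sphmAng_ode {θ : ℝ} (hθ : θ ∈ Ioo 0 Real.pi) :
    deriv (fun t ↦ (Real.sin t : ℂ) * deriv (sphmAng m ν κ) t) θ / (Real.sin θ : ℂ)
      - ((m : ℂ) ^ 2 / (Real.sin θ : ℂ) ^ 2 - κ * (Real.cos θ : ℂ) ^ 2) * sphmAng m ν κ θ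
      + (ν + (m : ℂ) * ((m : ℂ) + 1)) * sphmAng m ν κ θ = 0 := by
  -- notation
  set E := sphmEig m ν κ with hE_def
  have hsin : Real.sin θ ≠ 0 := (Real.sin_pos_of_pos_of_lt_pi hθ.1 hθ.2).ne'
  have hsC : (Real.sin θ : ℂ) ≠ 0 := by exact_mod_cast hsin
  -- derivatives of `u = E ∘ cos`
  have hu : ∀ t : ℝ, HasDerivAt (fun t ↦ E (Real.cos t)) (-(Real.sin t : ℂ) * deriv E (Real.cos t)) t := by
    intro t
    have := (hasDerivAt_sphmEig_cos hg t).scomp t (Real.hasDerivAt_cos t)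
    simpa [Function.comp_def, Complex.real_smul] using this
  have hu' : ∀ t : ℝ, HasDerivAt (fun t ↦ deriv E (Real.cos t)) (-(Real.sin t : ℂ) * deriv (deriv E) (Real.cos t)) t := by
    intro t
    have := (hasDerivAt_deriv_sphmEig_cos hg t).scomp t (Real.hasDerivAt_cos t)
    simpa [Function.comp_def, Complex.real_smul] using this
  have hsinC : ∀ t : ℝ, HasDerivAt (fun t : ℝ ↦ (Real.sin t : ℂ)) (Real.cos t : ℂ) t := fun t ↦
    (Real.hasDerivAt_sin t).ofReal_comp
  have hcosC : ∀ t : ℝ, HasDerivAt (fun t : ℝ ↦ (Real.cos t : ℂ)) (-(Real.sin t : ℂ)) t := fun t ↦ by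
    simpa using (Real.hasDerivAt_cos t).ofReal_comp
  -- first derivative of `S`
  have hS : ∀ t : ℝ, HasDerivAt (sphmAng m ν κ)
      ((m : ℂ) * (Real.sin t : ℂ) ^ (m - 1) * (Real.cos t : ℂ) * E (Real.cos t) +
        (Real.sin t : ℂ) ^ m * (-(Real.sin t : ℂ) * deriv E (Real.cos t))) t := fun t ↦
    (hasDerivAt_sin_pow m t).mul (hu t)
  -- `V = sin · S'` in closed form (no `m - 1` exponents)
  set V : ℝ → ℂ := fun t ↦ (m : ℂ) * (Real.cos t : ℂ) * (Real.sin t : ℂ) ^ m * E (Real.cos t) -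
    (Real.sin t : ℂ) ^ (m + 1) * ((Real.sin t : ℂ) * deriv E (Real.cos t)) with hV_def
  have hVeq : (fun t ↦ (Real.sin t : ℂ) * deriv (sphmAng m ν κ) t) = V := by
    funext t
    rw [(hS t).deriv, hV_def]
    have hp := natCast_mul_mul_pow_sub_one m (Real.sin t : ℂ)
    linear_combination ((Real.cos t : ℂ) * E (Real.cos t)) * hp
  -- derivative of `V`
  set s₀ : ℂ := (Real.sin θ : ℂ) with hs₀
  set c₀ : ℂ := (Real.cos θ : ℂ) with hc₀
  set A : ℂ := (m : ℂ) * (-s₀) * s₀ ^ m * E (Real.cos θ) +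
        (m : ℂ) * c₀ * ((m : ℂ) * s₀ ^ (m - 1) * c₀) * E (Real.cos θ) +
        (m : ℂ) * c₀ * s₀ ^ m * (-s₀ * deriv E (Real.cos θ)) -
        ((((m + 1 : ℕ) : ℂ)) * s₀ ^ (m + 1 - 1) * c₀ * (s₀ * deriv E (Real.cos θ)) +
          s₀ ^ (m + 1) * (c₀ * deriv E (Real.cos θ) + s₀ * (-s₀ * deriv (deriv E) (Real.cos θ)))) with hA_def
  have hV : HasDerivAt V A θ := by
    have h1 := ((((hcosC θ).const_mul (m : ℂ)).fun_mul (hasDerivAt_sin_pow m θ)).fun_mul (hu θ))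
    have h2 := (hasDerivAt_sin_pow (m + 1) θ).fun_mul ((hsinC θ).fun_mul (hu' θ))
    have h := h1.fun_sub h2
    rw [hV_def]
    convert h using 1
    all_goals first | rfl | (rw [hA_def]; ring)
  -- assemble
  rw [hVeq, hV.deriv]
  simp only [sphmAng]
  rw [← hE_def]
  have hp := natCast_mul_mul_pow_sub_one m s₀
  have hsc : s₀ ^ 2 + c₀ ^ 2 = 1 := by rw [hs₀, hc₀]; exact_mod_cast Real.sin_sq_add_cos_sq θ
  have hode := sphmEig_ode hg (cos_mem_Ioo θ)
  rw [← hE_def, ← hc₀] at hode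
  -- clear the denominators by hand
  rw [← mul_left_inj' (pow_ne_zero 2 hsC), zero_mul]
  have expand : (A / s₀ - ((m : ℂ) ^ 2 / s₀ ^ 2 - κ * c₀ ^ 2) * (s₀ ^ m * E (Real.cos θ)) +
      (ν + (m : ℂ) * ((m : ℂ) + 1)) * (s₀ ^ m * E (Real.cos θ))) * s₀ ^ 2 =
      A * s₀ - (m : ℂ) ^ 2 * (s₀ ^ m * E (Real.cos θ)) + κ * c₀ ^ 2 * s₀ ^ 2 * (s₀ ^ m * E (Real.cos θ)) +
        (ν + (m : ℂ) * ((m : ℂ) + 1)) * s₀ ^ 2 * (s₀ ^ m * E (Real.cos θ)) := by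
    field_simp
    ring
  rw [expand, hA_def]
  simp only [Nat.add_sub_cancel]
  push_cast
  -- `s^{m+2} · (x-equation at cos θ)` modulo the power identity and `sin² + cos² = 1`
  linear_combination s₀ ^ (m + 2) * hode + ((m : ℂ) * c₀ ^ 2 * E (Real.cos θ)) * hp +
    ((m : ℂ) ^ 2 * s₀ ^ m * E (Real.cos θ) + s₀ ^ (m + 2) * deriv (deriv E) (Real.cos θ)) * hsc

/-- **The angular function is smooth** (indeed on all of `ℝ`): `sin^m θ` is smooth and
`E ∘ cos` is the composition of the smooth glued solution on `(−9/4, 9/4) ∋ cos θ` with `cos`.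
[cite: ShlapentokhRothman2014KleinGordon, §2 (2.1)] -/
theorem contDiff_sphmAng : ContDiff ℝ ∞ (sphmAng m ν κ) := by
  have h1 : ContDiff ℝ ∞ (fun θ : ℝ ↦ (Real.sin θ : ℂ) ^ m) :=
    (Complex.ofRealCLM.contDiff.comp Real.contDiff_sin).pow m
  have h2 : ContDiff ℝ ∞ (fun θ : ℝ ↦ sphmEig m ν κ (Real.cos θ)) := by
    have hE := contDiffOn_sphmEig hg
    have hcos : ContDiffOn ℝ ∞ Real.cos univ := Real.contDiff_cos.contDiffOn
    have hmaps : MapsTo Real.cos univ (Ioo (-9 / 4 : ℝ) (9 / 4)) := fun θ _ ↦ cos_mem_Ioo θ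
    have h := hE.comp hcos hmaps
    rwa [contDiffOn_univ] at h
  exact h1.mul h2

/-- **The angular function is not identically zero**: `E(1) = 1`, so `E(cos θ) ≠ 0` for small
`θ > 0`, where `sin θ ≠ 0`. [folklore] -/
theorem exists_sphmAng_ne_zero : ∃ θ ∈ Ioo 0 Real.pi, sphmAng m ν κ θ ≠ 0 := by
  -- continuity of `θ ↦ E(cos θ)` at `0`, where the value is `1`
  have hcont : ContinuousAt (fun θ : ℝ ↦ sphmEig m ν κ (Real.cos θ)) 0 :=
    (contDiffAt_sphmEig hg (cos_mem_Ioo 0) le_rfl).continuousAt.comp_of_eq Real.continuous_cos.continuousAt rfl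
  have h1 : sphmEig m ν κ (Real.cos 0) = 1 := by rw [Real.cos_zero, sphmEig_one]
  have hev : ∀ᶠ θ : ℝ in 𝓝 0, sphmEig m ν κ (Real.cos θ) ≠ 0 := by
    have h := hcont.eventually_ne (by rw [h1]; exact one_ne_zero)
    exact h
  -- intersect with `(0, π)`-small positives
  have hpos : ∀ᶠ θ : ℝ in 𝓝[>] 0, θ ∈ Ioo 0 Real.pi := by
    have : Ioo (0 : ℝ) Real.pi ∈ 𝓝[>] (0 : ℝ) := Ioo_mem_nhdsGT Real.pi_pos
    filter_upwards [this] with θ hθ using hθ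
  obtain ⟨θ, hθE, hθI⟩ := ((hev.filter_mono nhdsWithin_le_nhds).and hpos).exists
  refine ⟨θ, hθI, ?_⟩
  rw [sphmAng]
  refine mul_ne_zero (pow_ne_zero _ ?_) hθE
  exact_mod_cast (Real.sin_pos_of_pos_of_lt_pi hθI.1 hθI.2).ne'

end Theta

end Literature.Analysis.SpecialFunctions

end
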